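/-
Origin: expansion seat `planner-pub-hodgecm-pv10-0`, handover #24 v2 2026-08-18T06:05:07Z (`HOME/pub-hodgecm-pv10/lean/Pv10/NormOneFromClassNumber.lean`, md5 5b049d18, 142 lines);
landed by the gen-6 packager in gate run 24 as `HodgeCM/PerL34/NormOneFromClassNumber.lean` (import ^import Pv[0-9]+\.→import HodgeCM.PerL34. ×1).
-/
/-
# `C¹_K` compact ⇐ (class number finite, idelic form) + (archimedean shells compact modulo `K^×`)

WIP module `Pv10.NormOneFromClassNumber` (pub-hodgecm-pv10); intended landing
`HodgeCM/PerL34/NormOneFromClassNumber.lean`.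

Node N15, the one print input `NormOneIdeleClassesCompact` of PerL v5 tex l. 311.  This file types the
TWO classical theorems from which the compactness of `C¹_K` is classically assembled, in idelic
form over Mathlib's adeles, and proves the assembly in the kernel:

* `IdeleClassNumberFinite K` (typed, NOT asserted): finitely many ideles `y₁,…,y_h` with
  `𝔸_K^× = ⋃ᵢ yᵢ · K^× · (K_∞^× · ∏_v 𝒪_v^×)` — finiteness of the class number in idelic form
  (print: Cassels–Fröhlich II §17 THEOREM "D_k^0 modulo principal divisors is a finite group",
  PDF p. 122; Neukirch I (6.3)); Mathlib has `Fintype (ClassGroup (𝓞 K))`, the missing glue is the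
  idele ↦ fractional-ideal map;
* `ArchShellCompactModPrincipal K` (typed, NOT asserted): for every `c > 0` a compact
  `S ⊆ K_∞^×` such that every `a ∈ K_∞^×` of norm `c` is moved by a principal idele into the box
  `S · ∏_v 𝒪_v^×` — the compactness half of Dirichlet's unit theorem (print: C–F II §17 "Unit
  theorem" p. 122 / §18; Neukirch I (7.3)); Mathlib has `NumberField.Units.dirichletUnitTheorem` (the
  log-unit lattice is a full lattice), the missing glue is the passage lattice ↦ compact shell;
* `normOneIdeleClassesCompact_of_classNumber_of_shells`: the two together give
  `NormOneIdeleClassesCompact K` (via `IdeleBoxes.normOneIdeleClassesCompact_of_boxes`).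

Nothing is asserted; Mathlib only.
-/
import Summits.HodgeConjecture.HodgeCM.PerL34.IdeleBoxes

/-! PORT of `HodgeCM/PerL34/NormOneFromClassNumber.lean` (HodgeCMPerL run 82) — verbatim mechanical port; provenance in the PORT header line. -/

set_option autoImplicit false

noncomputable section

open Topology Filter Set Function Pointwise

namespace NumberField

open IsDedekindDomain

variable (K : Type*) [Field K] [NumberField K]

/-- **(CL) typed, NOT asserted.**  Finiteness of the class number, idelic form: finitely many ideles
represent `𝔸_K^×` modulo `K^× · (K_∞^× · ∏_v 𝒪_v^×)` (the quotient is `Cl_K`). -/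
def IdeleClassNumberFinite : Prop :=
  ∃ F : Finset (ideleGroup K), ∀ x : ideleGroup K, ∃ k ∈ principalIdeles K, ∃ y ∈ F,
    ∃ p : (InfiniteAdeleRing K)ˣ × (integralAdeles K)ˣ, x * k = y * unitBox K p

/-- **(UT) typed, NOT asserted.**  The archimedean norm-`c` shell is compact modulo principal ideles:
for every `c > 0` there is a compact `S ⊆ K_∞^×` such that every `a ∈ K_∞^×` with `‖a‖ = c` satisfies
`a_∞ · k ∈ S · ∏_v 𝒪_v^×` for some principal idele `k` (necessarily a global unit). -/
def ArchShellCompactModPrincipal : Prop :=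
  ∀ c : ℝ, 0 < c → ∃ S : Set (InfiniteAdeleRing K)ˣ, IsCompact S ∧
    ∀ a : (InfiniteAdeleRing K)ˣ, ‖(a : InfiniteAdeleRing K)‖ = c →
      ∃ k ∈ principalIdeles K, ∃ a' ∈ S, ∃ u' : (integralAdeles K)ˣ,
        infUnitsToIdele K a * k = unitBox K (a', u')

/-- (Ported verbatim from the HodgeCMPerL package; no docstring in the source.) -/
theorem ideleNorm_unitBox (p : (InfiniteAdeleRing K)ˣ × (integralAdeles K)ˣ) :
    ideleNorm K (unitBox K p) = ‖(p.1 : InfiniteAdeleRing K)‖ := by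
  rw [unitBox_apply, map_mul, ideleNorm_infUnitsToIdele, ideleNorm_intUnitsToIdele, mul_one]

/-- **`C¹_K` is compact, given (CL) and (UT).**  The kernel assembly of the classical proof. -/
theorem normOneIdeleClassesCompact_of_classNumber_of_shells (hCL : IdeleClassNumberFinite K)
    (hUT : ArchShellCompactModPrincipal K) : NormOneIdeleClassesCompact K := by
  obtain ⟨F, hF⟩ := hCL
  -- one compact shell per representative `y`, at archimedean norm `|y|⁻¹`
  have hc : ∀ y : ideleGroup K, 0 < (ideleNorm K y)⁻¹ := fun y => inv_pos.mpr (ideleNorm_pos K y)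
  choose S hSc hS using fun y : ideleGroup K => hUT _ (hc y)
  refine normOneIdeleClassesCompact_of_boxes K (S := ⋃ y ∈ F, S y)
    (F.isCompact_biUnion fun y _ => hSc y) F fun x hx => ?_
  obtain ⟨k₁, hk₁, y, hy, ⟨a, u⟩, h₁⟩ := hF x
  -- the archimedean norm of `a` is forced: `1 = |x k₁| = |y| · ‖a‖`
  have hnorm : ‖(a : InfiniteAdeleRing K)‖ = (ideleNorm K y)⁻¹ := by
    have h : ideleNorm K y * ‖(a : InfiniteAdeleRing K)‖ = 1 := by
      have hxk : ideleNorm K (x * k₁) = 1 := by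
        rw [map_mul, (mem_normOneIdeles_iff K x).mp hx, ideleNorm_eq_one_of_mem_principalIdeles K hk₁,
          mul_one]
      rw [← hxk, h₁, map_mul, ideleNorm_unitBox]
    calc ‖(a : InfiniteAdeleRing K)‖
        = (ideleNorm K y)⁻¹ * (ideleNorm K y * ‖(a : InfiniteAdeleRing K)‖) := by
          rw [← mul_assoc, inv_mul_cancel₀ (ideleNorm_pos K y).ne', one_mul]
      _ = (ideleNorm K y)⁻¹ := by rw [h, mul_one]
  obtain ⟨k₂, hk₂, a', ha', u', h₂⟩ := hS y a hnorm
  refine ⟨k₁ * k₂, mul_mem hk₁ hk₂, y, hy, ?_⟩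
  have hxkk : x * (k₁ * k₂) = y * unitBox K (a', u' * u) := by
    calc x * (k₁ * k₂) = x * k₁ * k₂ := (mul_assoc _ _ _).symm
      _ = y * (infUnitsToIdele K a * intUnitsToIdele K u) * k₂ := by rw [h₁, unitBox_apply]
      _ = y * (infUnitsToIdele K a * k₂ * intUnitsToIdele K u) := by
          rw [mul_assoc, mul_assoc, mul_comm (intUnitsToIdele K u) k₂, ← mul_assoc (infUnitsToIdele K a)]
      _ = y * (unitBox K (a', u') * intUnitsToIdele K u) := by rw [h₂]
      _ = y * unitBox K (a', u' * u) := by rw [unitBox_apply, unitBox_apply, map_mul, mul_assoc]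
  rw [hxkk, ← smul_eq_mul]
  exact smul_mem_smul_set (mem_image_of_mem _ (mk_mem_prod (mem_iUnion₂.mpr ⟨y, hy, ha'⟩) (mem_univ _)))

/-! ## Global units in the unit box

The glue both (CL) and (UT) need: a global unit `ε ∈ 𝓞_K^×` sits in the unit box as
`(ε_∞, ε_f) ∈ K_∞^× × ∏_v 𝒪_v^×`, and `unitBox (ε_∞, ε_f)` is the principal idele of `ε`. -/

/-- Global units into `∏_v 𝒪_v^×`. -/
def unitsToIntUnits : (𝓞 K)ˣ →* (integralAdeles K)ˣ :=
  Units.map (algebraMap (𝓞 K) (integralAdeles K) : 𝓞 K →* integralAdeles K)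

/-- Global units into `K_∞^×`. -/
def unitsToInfUnits : (𝓞 K)ˣ →* (InfiniteAdeleRing K)ˣ :=
  Units.map ((algebraMap K (InfiniteAdeleRing K)).comp (algebraMap (𝓞 K) K) :
    𝓞 K →* InfiniteAdeleRing K)

/-- Global units as principal ideles. -/
def unitsToIdele : (𝓞 K)ˣ →* ideleGroup K :=
  (Units.map (algebraMap K (AdeleRing (𝓞 K) K) : K →* AdeleRing (𝓞 K) K)).comp
    (Units.map (algebraMap (𝓞 K) K : 𝓞 K →* K))

/-- (Ported verbatim from the HodgeCMPerL package; no docstring in the source.) -/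
theorem unitsToIdele_mem_principalIdeles (ε : (𝓞 K)ˣ) : unitsToIdele K ε ∈ principalIdeles K :=
  ⟨Units.map (algebraMap (𝓞 K) K : 𝓞 K →* K) ε, rfl⟩

/-- `unitBox (ε_∞, ε_f)` is the principal idele of the global unit `ε`. -/
theorem unitBox_units (ε : (𝓞 K)ˣ) :
    unitBox K (unitsToInfUnits K ε, unitsToIntUnits K ε) = unitsToIdele K ε := by
  rw [unitBox_apply, infUnitsToIdele_mul_intUnitsToIdele]
  refine Units.ext (Prod.ext rfl (Subtype.ext (funext fun v => rfl)))

/-- Hence a global unit moves `a ∈ K_∞^×` inside the unit box by a PRINCIPAL idele: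
`a_∞ · (ε) = unitBox (a · ε_∞, ε_f)`. -/
theorem infUnitsToIdele_mul_unitsToIdele (a : (InfiniteAdeleRing K)ˣ) (ε : (𝓞 K)ˣ) :
    infUnitsToIdele K a * unitsToIdele K ε = unitBox K (a * unitsToInfUnits K ε, unitsToIntUnits K ε) := by
  rw [← unitBox_units, unitBox_apply, unitBox_apply, map_mul, mul_assoc]

/-- (UT) from its global-units form: if for every `c > 0` a compact `S ⊆ K_∞^×` absorbs every norm-`c`
element up to a global unit, then `ArchShellCompactModPrincipal K`. -/
theorem archShellCompactModPrincipal_of_units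
    (h : ∀ c : ℝ, 0 < c → ∃ S : Set (InfiniteAdeleRing K)ˣ, IsCompact S ∧
      ∀ a : (InfiniteAdeleRing K)ˣ, ‖(a : InfiniteAdeleRing K)‖ = c →
        ∃ ε : (𝓞 K)ˣ, a * unitsToInfUnits K ε ∈ S) :
    ArchShellCompactModPrincipal K := by
  intro c hc
  obtain ⟨S, hS, hSc⟩ := h c hc
  refine ⟨S, hS, fun a ha => ?_⟩
  obtain ⟨ε, hε⟩ := hSc a ha
  exact ⟨unitsToIdele K ε, unitsToIdele_mem_principalIdeles K ε, a * unitsToInfUnits K ε, hε,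
    unitsToIntUnits K ε, infUnitsToIdele_mul_unitsToIdele K a ε⟩

end NumberField

end
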